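import Mathlib
import Literature.Geometry.Lorentzian.KerrSurfaceGravity
import Summits.FinalStateConjecture.FinalStateConjecture.Theses.PhaseMixingCapture
import Summits.FinalStateConjecture.FinalStateConjecture.Theorems.NearExtremalKappaCapture.Negative.ExponentMonotonicity

/-!
# Sketch (crux-ideate, crux `NearExtremalKappaCapture` = stmt-FinalStateConjecture-10606,
# round 1, ideator 2, generation 2) — first lemmas of the two idea cards

* Card A `first-law-free-energy`: the frozen-weight free energy
  `𝓕 = M_B − Ω_H(M,J) J_B − κ(M,J) A/8π` along the fixed-`J` Kerr family; first law at fixed `J`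
  (`hasDerivAt_areaMJ`), criticality at the target (`hasDerivAt_freeEnergyFam_self`), the
  log-derivative of the surface gravity at fixed `J` (`hasDerivAt_log_kappaMJ`) and the DAVIES SIGN
  (`davies_sign`: the frozen free energy is a WELL along the family iff `√(1 − a²/M²) < √3 − 1`, i.e.
  `a/M > (2√3 − 3)^{1/2} = 0.6812…`), the rim identity (`rim_eq`).
* Card B `horizon-weight-calculus`: the red-shift takeover arithmetic (`pow_mul_exp_neg_le`:
  `v^k e^{−κv} ≤ k!/κ^k`), the damped Riccati caricature of a non-null horizon term
  (`riccatiSol`, `riccatiSol_le`: basin `b z₀ < κ`, i.e. polynomial in `κ`, never `exp(−c/κ)`), the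
  weight-excess inequality (`weightExcess_le`), and the polar photon-orbit gap
  (`polar_orbit_gap`: axisymmetric trapping stays at `r ≥ (1 + √2)M > r₊ + 0.41M` for all `|a| ≤ M`).

Everything is elementary real analysis over existing declarations (`Kerr.surfaceGravity`,
`Kerr.rPlus`); nothing here is an item. ALL PROVED (no `sorry`): `kappaMJ_eq_surfaceGravity`, `hasDerivAt_areaMJ` (first law at fixed `J`),
`hasDerivAt_freeEnergyFam_self`, `hasDerivAt_log_kappaMJ`, `davies_sign`, `rim_eq`, `pow_mul_exp_neg_le`,
`riccatiSol_le`, `weightExcess_le`, `polar_orbit_gap` (the derivative values were also checked numerically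
to 1e-6 in the session, NOTES.md).
-/

noncomputable section

set_option linter.dupNamespace false

namespace Summit.FinalStateConjecture.FinalStateConjecture.Cruxes.NearExtremalKappaCapture.Ideator2Gen2

open Real
open Literature.Geometry.Lorentzian

/-! ## Card A — `first-law-free-energy` -/

/-- Kerr horizon area as a function of mass and angular momentum: `A(M,J) = 8π(M² + √(M⁴ − J²))`
(`= 4π(r₊² + a²) = 8π M r₊`, `J = aM`). -/
def areaMJ (M J : ℝ) : ℝ := 8 * π * (M ^ 2 + √(M ^ 4 - J ^ 2))

/-- Kerr surface gravity as a function of `(M, J)` (Townsend's form, `= Kerr.surfaceGravity M (J/M)`):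
`κ(M,J) = √(M⁴ − J²) / (2M(M² + √(M⁴ − J²)))`. -/
def kappaMJ (M J : ℝ) : ℝ := √(M ^ 4 - J ^ 2) / (2 * M * (M ^ 2 + √(M ^ 4 - J ^ 2)))

/-- Horizon angular velocity `Ω_H = a/(r₊² + a²) = J/(2M(M² + √(M⁴ − J²)))`. -/
def omegaMJ (M J : ℝ) : ℝ := J / (2 * M * (M ^ 2 + √(M ^ 4 - J ^ 2)))

/-- The `(M,J)`-form of the surface gravity agrees with the tree's `Kerr.surfaceGravity M a`, `a = J/M`.
(Algebra: `√(M⁴ − J²) = M√(M² − a²)`, `r₊² + a² = 2Mr₊ = 2(M² + √(M⁴ − J²))/1`.) -/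
theorem kappaMJ_eq_surfaceGravity {M : ℝ} (hM : 0 < M) (J : ℝ) (hJ : J ^ 2 ≤ M ^ 4) :
    kappaMJ M J = Kerr.surfaceGravity M (J / M) := by
  have hM0 : M ≠ 0 := hM.ne'
  have hin : M ^ 2 - (J / M) ^ 2 = (M ^ 4 - J ^ 2) / M ^ 2 := by
    field_simp
  have hs : √(M ^ 2 - (J / M) ^ 2) = √(M ^ 4 - J ^ 2) / M := by
    rw [hin, Real.sqrt_div' _ (sq_nonneg M), Real.sqrt_sq hM.le]
  set u := √(M ^ 4 - J ^ 2) with hu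
  have hu2 : u ^ 2 = M ^ 4 - J ^ 2 := Real.sq_sqrt (by linarith)
  have hu0 : 0 ≤ u := Real.sqrt_nonneg _
  unfold kappaMJ Kerr.surfaceGravity Kerr.rPlus
  rw [hs]
  have hden : (M + u / M) ^ 2 + (J / M) ^ 2 = 2 * M ^ 2 + 2 * u := by
    have h1 : (M + u / M) ^ 2 + (J / M) ^ 2 = (M ^ 4 + 2 * M ^ 2 * u + u ^ 2 + J ^ 2) / M ^ 2 := by
      field_simp
      ring
    rw [h1, hu2]
    field_simp
    ring
  rw [hden]
  have h2 : 0 < 2 * M ^ 2 + 2 * u := by positivity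
  field_simp
  ring

/-- **First law of black hole mechanics at fixed `J`** (Bardeen–Carter–Hawking; Wald 1984 (12.5.x)):
`∂A/∂M |_J = 8π/κ`. Elementary calculus on the closed form; checked numerically in the session. -/
theorem hasDerivAt_areaMJ {M J : ℝ} (hM : 0 < M) (hJ : J ^ 2 < M ^ 4) :
    HasDerivAt (fun M' => areaMJ M' J) (8 * π / kappaMJ M J) M := by
  have hu : 0 < M ^ 4 - J ^ 2 := by linarith
  have hu' : 0 < √(M ^ 4 - J ^ 2) := Real.sqrt_pos.mpr hu
  have h1 : HasDerivAt (fun M' : ℝ => M' ^ 4 - J ^ 2) (4 * M ^ 3) M := by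
    simpa using (hasDerivAt_pow 4 M).sub_const (J ^ 2)
  have h2 : HasDerivAt (fun M' : ℝ => √(M' ^ 4 - J ^ 2))
      (4 * M ^ 3 / (2 * √(M ^ 4 - J ^ 2))) M := h1.sqrt hu.ne'
  have h3 : HasDerivAt (fun M' : ℝ => M' ^ 2 + √(M' ^ 4 - J ^ 2))
      (2 * M + 4 * M ^ 3 / (2 * √(M ^ 4 - J ^ 2))) M := by
    have h0 : HasDerivAt (fun M' : ℝ => M' ^ 2) (2 * M) M := by
      simpa using hasDerivAt_pow 2 M
    exact h0.add h2
  have h4 := h3.const_mul (8 * π)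
  have hfun : (fun M' => areaMJ M' J) = fun M' : ℝ => 8 * π * (M' ^ 2 + √(M' ^ 4 - J ^ 2)) := rfl
  rw [hfun]
  refine h4.congr_deriv ?_
  unfold kappaMJ
  have hM0 : M ≠ 0 := hM.ne'
  have hne : √(M ^ 4 - J ^ 2) ≠ 0 := hu'.ne'
  have hden : (M ^ 2 + √(M ^ 4 - J ^ 2)) ≠ 0 := by positivity
  field_simp
  ring

/-- The **frozen-weight free energy along the fixed-`J` Kerr family**: the first-law weights
`κ₀ = κ(M₀,J)` (and `Ω₀`, invisible at fixed `J`) are FROZEN at the target hole `(M₀, J)`;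
`F(M) = M − κ₀ A(M,J)/8π` (the `−Ω₀ J` term is constant along the fixed-`J` family and dropped). -/
def freeEnergyFam (M₀ J M : ℝ) : ℝ := M - kappaMJ M₀ J * areaMJ M J / (8 * π)

/-- **Criticality at the target** (= the first law): `F'(M₀) = 1 − κ₀ · (8π/κ₀)/8π = 0`. -/
theorem hasDerivAt_freeEnergyFam_self {M J : ℝ} (hM : 0 < M) (hJ : J ^ 2 < M ^ 4)
    (hκ : kappaMJ M J ≠ 0) :
    HasDerivAt (freeEnergyFam M J) 0 M := by
  have hA := hasDerivAt_areaMJ hM hJ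
  have h1 : HasDerivAt (fun M' => kappaMJ M J * areaMJ M' J / (8 * π))
      (kappaMJ M J * (8 * π / kappaMJ M J) / (8 * π)) M :=
    (hA.const_mul (kappaMJ M J)).div_const (8 * π)
  have h2 : kappaMJ M J * (8 * π / kappaMJ M J) / (8 * π) = 1 := by
    have hπ : (8 : ℝ) * π ≠ 0 := by positivity
    field_simp
  rw [h2] at h1
  have h3 := (hasDerivAt_id M).sub h1
  simp only [sub_self] at h3
  exact h3

/-- **Log-derivative of the surface gravity at fixed `J`** (session computation, checked numerically):
with `u = √(M⁴ − J²)` (so that `s := u/M² = √(1 − a²/M²)`),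
`∂_M log κ |_J = (2M⁴ − 2M²u − u²)/(M u²) = (2 − 2s − s²)/(M s²)`.
Consequently `F''(M₀) = κ₀ κ'(M₀)/κ₀² = (2 − 2s − s²)/(M₀ s²)`, which is `≈ 2/(M₀ (1 − a²/M²))` near
extremality: the well sharpens like `χ⁻¹`. PROVED (quotient rule; no use of `u² = M⁴ − J²`). -/
theorem hasDerivAt_log_kappaMJ {M J : ℝ} (hM : 0 < M) (hJ : J ^ 2 < M ^ 4) :
    HasDerivAt (fun M' => Real.log (kappaMJ M' J))
      ((2 * M ^ 4 - 2 * M ^ 2 * √(M ^ 4 - J ^ 2) - (√(M ^ 4 - J ^ 2)) ^ 2) /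
        (M * (√(M ^ 4 - J ^ 2)) ^ 2)) M := by
  have hu : 0 < M ^ 4 - J ^ 2 := by linarith
  have hu' : 0 < √(M ^ 4 - J ^ 2) := Real.sqrt_pos.mpr hu
  have hM0 : M ≠ 0 := hM.ne'
  have hne : √(M ^ 4 - J ^ 2) ≠ 0 := hu'.ne'
  have hden : (M ^ 2 + √(M ^ 4 - J ^ 2)) ≠ 0 := by positivity
  have h1 : HasDerivAt (fun M' : ℝ => M' ^ 4 - J ^ 2) (4 * M ^ 3) M := by
    simpa using (hasDerivAt_pow 4 M).sub_const (J ^ 2)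
  have hc : HasDerivAt (fun M' : ℝ => √(M' ^ 4 - J ^ 2))
      (4 * M ^ 3 / (2 * √(M ^ 4 - J ^ 2))) M := h1.sqrt hu.ne'
  have ha : HasDerivAt (fun M' : ℝ => 2 * M') 2 M := by
    simpa using (hasDerivAt_id M).const_mul (2 : ℝ)
  have hb : HasDerivAt (fun M' : ℝ => M' ^ 2 + √(M' ^ 4 - J ^ 2))
      (2 * M + 4 * M ^ 3 / (2 * √(M ^ 4 - J ^ 2))) M := by
    have h0 : HasDerivAt (fun M' : ℝ => M' ^ 2) (2 * M) M := by
      simpa using hasDerivAt_pow 2 M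
    exact h0.add hc
  have hd : HasDerivAt (fun M' : ℝ => 2 * M' * (M' ^ 2 + √(M' ^ 4 - J ^ 2)))
      (2 * (M ^ 2 + √(M ^ 4 - J ^ 2)) +
        2 * M * (2 * M + 4 * M ^ 3 / (2 * √(M ^ 4 - J ^ 2)))) M := ha.mul hb
  have hdx : 2 * M * (M ^ 2 + √(M ^ 4 - J ^ 2)) ≠ 0 := by positivity
  have hκ : HasDerivAt (fun M' => kappaMJ M' J)
      ((4 * M ^ 3 / (2 * √(M ^ 4 - J ^ 2)) * (2 * M * (M ^ 2 + √(M ^ 4 - J ^ 2))) -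
          √(M ^ 4 - J ^ 2) * (2 * (M ^ 2 + √(M ^ 4 - J ^ 2)) +
            2 * M * (2 * M + 4 * M ^ 3 / (2 * √(M ^ 4 - J ^ 2))))) /
        (2 * M * (M ^ 2 + √(M ^ 4 - J ^ 2))) ^ 2) M := hc.div hd hdx
  have hκ0 : kappaMJ M J ≠ 0 := by
    unfold kappaMJ
    positivity
  refine (hκ.log hκ0).congr_deriv ?_
  unfold kappaMJ
  field_simp
  ring

/-- **Davies sign.** For `0 < s` (`s = √(1 − a²/M²) = √χ`): the curvature numerator `2 − 2s − s²` of the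
frozen free energy is positive iff `s < √3 − 1`, i.e. iff `a²/M² > 2√3 − 3` (`a/M > 0.6812…`, Davies'
point where the specific heat at fixed `J` changes sign, Proc. R. Soc. A 353 (1977) 499). So the
free energy is a WELL along the family exactly on the near-extremal side. -/
theorem davies_sign {s : ℝ} (hs0 : 0 < s) :
    0 < 2 - 2 * s - s ^ 2 ↔ s < √3 - 1 := by
  have h3 : (0 : ℝ) ≤ 3 := by norm_num
  constructor
  · intro h
    have hsq : (s + 1) ^ 2 < 3 := by nlinarith
    have : s + 1 < √3 := (Real.lt_sqrt (by linarith)).mpr hsq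
    linarith
  · intro h
    have h1 : s + 1 < √3 := by linarith
    have hsq : (s + 1) ^ 2 < 3 := (Real.lt_sqrt (by linarith)).mp h1
    nlinarith

/-- **Rim identity.** The height of the extremal member (`M = √J`, `J ≥ 0`) above the target in the
frozen free energy: `F(√J) − F(M₀) = κ₀ (A(M₀,J) − 8πJ)/8π − (M₀ − √J)`.
Near extremality this equals `(M₀ − √J)(1 + O(s))` (numerics in NOTES.md: ratio 0.585 at `a = 0.9M`,
0.863 at `0.99M`, 0.986 at `0.9999M`), and `M₀ − √(aM₀) ≥ M₀(1 − a²/M₀²)/4` is the Disproof's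
`extremalityGap_ge`: a development whose free energy starts below the rim can never become
quasi-stationary at extremality (third-law fork closed at the energetic floor `γ = 1/2`). -/
theorem rim_eq {M₀ J : ℝ} (hJ : 0 ≤ J) :
    freeEnergyFam M₀ J (√J) - freeEnergyFam M₀ J M₀ =
      kappaMJ M₀ J * (areaMJ M₀ J - 8 * π * J) / (8 * π) - (M₀ - √J) := by
  have hs4 : (√J) ^ 4 = J ^ 2 := by
    rw [show (4 : ℕ) = 2 * 2 from rfl, pow_mul, Real.sq_sqrt hJ]
  have hA : areaMJ (√J) J = 8 * π * J := by
    unfold areaMJ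
    rw [hs4, sub_self, Real.sqrt_zero, add_zero, Real.sq_sqrt hJ]
  unfold freeEnergyFam
  rw [hA]
  have hπ : (8 : ℝ) * π ≠ 0 := by positivity
  field_simp
  ring

/-- The Disproof's energetic gap, re-read as the rim height to leading order (imported, landed):
`M/4 · (1 − (a/M)²) ≤ M − √(aM)`. -/
example {M a : ℝ} (hM : 0 < M) (ha0 : 0 ≤ a) (haM : a ≤ M) :
    M / 4 * (1 - (a / M) ^ 2) ≤ M - √(a * M) :=
  Theorems.NearExtremalKappaCapture.Negative.extremalityGap_ge hM ha0 haM

/-! ## Card B — `horizon-weight-calculus` -/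

/-- **Red-shift takeover arithmetic.** A transient growing like `v^k` is beaten by the red-shift
factor `e^{−κv}` at the cost of exactly `κ^{−k}`: `v^k e^{−κv} ≤ k!/κ^k` (`sup` at `v = k/κ`). This is
how a polynomial-in-`v` extremal transient becomes a polynomial-in-`κ⁻¹` constant, never `e^{c/κ}`. -/
theorem pow_mul_exp_neg_le {κ v : ℝ} (hκ : 0 < κ) (hv : 0 ≤ v) (k : ℕ) :
    v ^ k * Real.exp (-(κ * v)) ≤ (k.factorial : ℝ) / κ ^ k := by
  have hx : 0 ≤ κ * v := by positivity
  have h1 := Real.pow_div_factorial_le_exp (κ * v) hx k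
  have hk : (0 : ℝ) < k.factorial := by exact_mod_cast k.factorial_pos
  have hκk : 0 < κ ^ k := pow_pos hκ k
  rw [le_div_iff₀ hκk]
  rw [div_le_iff₀ hk] at h1
  have h3 : Real.exp (κ * v) * Real.exp (-(κ * v)) = 1 := by
    rw [← Real.exp_add]; simp
  calc v ^ k * Real.exp (-(κ * v)) * κ ^ k = (κ * v) ^ k * Real.exp (-(κ * v)) := by ring
    _ ≤ Real.exp (κ * v) * (k.factorial : ℝ) * Real.exp (-(κ * v)) :=
        mul_le_mul_of_nonneg_right h1 (Real.exp_pos _).le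
    _ = (k.factorial : ℝ) := by
        rw [mul_comm (Real.exp _) _, mul_assoc, h3, mul_one]

/-- **Damped Riccati caricature** of a NON-null quadratic horizon term (`∂_v z = −κ z + b z²`,
Aretakis 2013's ODE-type blow-up mechanism with the red-shift switched on): the explicit solution. -/
def riccatiSol (κ b z₀ v : ℝ) : ℝ :=
  κ * z₀ * Real.exp (-(κ * v)) / (κ - b * z₀ * (1 - Real.exp (-(κ * v))))

/-- **Polynomial basin of the damped Riccati term.** Inside the basin `b z₀ < κ` the solution is
global and bounded by `κ z₀/(κ − b z₀)`; outside it blows up in finite advanced time. So even the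
WORST horizon nonlinearity (no null structure) costs a basin linear in `κ` — a fixed power, never
`exp(−c/κ)`; a degree-`q` term gives `z₀ ≲ κ^{1/(q−1)}`. -/
theorem riccatiSol_le {κ b z₀ v : ℝ} (hκ : 0 < κ) (hb : 0 ≤ b) (hz : 0 ≤ z₀) (hbasin : b * z₀ < κ)
    (hv : 0 ≤ v) : riccatiSol κ b z₀ v ≤ κ * z₀ / (κ - b * z₀) := by
  unfold riccatiSol
  have he0 : 0 < Real.exp (-(κ * v)) := Real.exp_pos _
  have he1 : Real.exp (-(κ * v)) ≤ 1 := by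
    rw [Real.exp_le_one_iff]; nlinarith
  have hden : 0 < κ - b * z₀ := by linarith
  have hbz : 0 ≤ b * z₀ := mul_nonneg hb hz
  have hden' : κ - b * z₀ ≤ κ - b * z₀ * (1 - Real.exp (-(κ * v))) := by nlinarith
  have hden'' : 0 < κ - b * z₀ * (1 - Real.exp (-(κ * v))) := lt_of_lt_of_le hden hden'
  rw [div_le_div_iff₀ hden'' hden]
  have hnum : κ * z₀ * Real.exp (-(κ * v)) ≤ κ * z₀ := by
    have : 0 ≤ κ * z₀ := mul_nonneg hκ.le hz
    nlinarith
  calc κ * z₀ * Real.exp (-(κ * v)) * (κ - b * z₀)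
      ≤ κ * z₀ * (κ - b * z₀) := by nlinarith [mul_nonneg (mul_nonneg hκ.le hz) hden.le]
    _ ≤ κ * z₀ * (κ - b * z₀ * (1 - Real.exp (-(κ * v)))) :=
        mul_le_mul_of_nonneg_left hden' (mul_nonneg hκ.le hz)

/-- **Weight-excess inequality** (the arithmetic of the horizon weight calculus). A quadratic coupling
`z_j z_l → z_k` of horizon quantities with transient exponents `a_j, a_l, a_k` (linear sizes
`ε v^{a}` on the thermal window `v ≤ κ⁻¹`) deposits `ε² κ^{−(a_j + a_l + 1)}` into `z_k`, whose own
linear size is `ε κ^{−a_k}`; the deposit is subordinate iff `ε ≤ κ^e` with the WEIGHT EXCESS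
`e = a_j + a_l + 1 − a_k`. Here: the forward direction as an inequality for `0 < κ ≤ 1`. -/
theorem weightExcess_le {κ ε aj al ak : ℝ} (hκ : 0 < κ) (hε : 0 ≤ ε)
    (h : ε ≤ κ ^ (aj + al + 1 - ak)) :
    ε ^ 2 * κ ^ (-(aj + al + 1)) ≤ ε * κ ^ (-ak) := by
  have hk1 : 0 < κ ^ (-(aj + al + 1)) := Real.rpow_pos_of_pos hκ _
  have key : κ ^ (aj + al + 1 - ak) * κ ^ (-(aj + al + 1)) = κ ^ (-ak) := by
    rw [← Real.rpow_add hκ]; ring_nf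
  calc ε ^ 2 * κ ^ (-(aj + al + 1)) = ε * (ε * κ ^ (-(aj + al + 1))) := by ring
    _ ≤ ε * (κ ^ (aj + al + 1 - ak) * κ ^ (-(aj + al + 1))) := by
        apply mul_le_mul_of_nonneg_left _ hε
        exact mul_le_mul_of_nonneg_right h hk1.le
    _ = ε * κ ^ (-ak) := by rw [key]

/-- **Polar photon-orbit gap** (axisymmetric trapping stays uniformly off the horizon). The radius of
the spherical photon orbit with `L_z = 0` on Kerr(M,a) is the root in `(M, ∞)` of
`p(r) = r³ − 3Mr² + a²r + a²M` (`ξ = L_z/E = 0` in Teo's parametrisation); since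
`p(r) = (r − M)(r² − 2Mr − M²) − (M² − a²)(r + M)`, `p < 0` on `(M, (1+√2)M)` for every `|a| ≤ M`:
the `m = 0` trapped set lies at `r ≥ (1 + √2)M ≈ 2.414M`, whereas `r₊ ≤ 2M` — a gap `≥ 0.41M`
UNIFORM through extremality (at `a = M`: `p = (r − M)(r² − 2Mr − M²)` exactly). -/
theorem polar_orbit_gap {M a r : ℝ} (hM : 0 < M) (ha : |a| ≤ M) (hr1 : M < r)
    (hr2 : r < (1 + √2) * M) : r ^ 3 - 3 * M * r ^ 2 + a ^ 2 * r + a ^ 2 * M < 0 := by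
  have h2 : (√2) ^ 2 = 2 := Real.sq_sqrt (by norm_num)
  have hs2 : 0 ≤ √2 := Real.sqrt_nonneg 2
  have ha2 : a ^ 2 ≤ M ^ 2 := by
    have := abs_le.mp ha
    nlinarith [sq_abs a, abs_nonneg a]
  have hrm : 0 < r - M := by linarith
  have hrm2 : r - M < √2 * M := by linarith
  have hq : r ^ 2 - 2 * M * r - M ^ 2 < 0 := by
    have : (r - M) ^ 2 < (√2 * M) ^ 2 := by
      apply sq_lt_sq' _ hrm2
      nlinarith [mul_pos (show (0:ℝ) < √2 + 1 by linarith) hM]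
    nlinarith
  have key : r ^ 3 - 3 * M * r ^ 2 + a ^ 2 * r + a ^ 2 * M
      = (r - M) * (r ^ 2 - 2 * M * r - M ^ 2) - (M ^ 2 - a ^ 2) * (r + M) := by ring
  rw [key]
  have hA : (r - M) * (r ^ 2 - 2 * M * r - M ^ 2) < 0 := mul_neg_of_pos_of_neg hrm hq
  have hB : 0 ≤ (M ^ 2 - a ^ 2) * (r + M) := mul_nonneg (by linarith) (by linarith)
  linarith

/-! ## How the cards face the crux (statements only; the crux is fixed) -/

/-- The crux, by name (fixed by the route; nothing here restates or weakens it). -/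
example : Prop := Theses.PhaseMixingCapture.NearExtremalKappaCapture

end Summit.FinalStateConjecture.FinalStateConjecture.Cruxes.NearExtremalKappaCapture.Ideator2Gen2

end
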